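import Summits.Ventures.WeilGRH.RigidityDataA03465
import HarnessLib

/-!
# rh-explicit (venture WeilGRH): validity of the PRIME-FREE rung's special-value table (`a = 693/2000`, no prime power) — input of the
  Christoffel certificates «no prime needed» (weil-3 gen18)

Cell `rh-explicit`, WEIL TRACK (structure seat weil-3, gen18).  Kernel certificates only: a Boolean conjunction (`checks_primeFree`), two table-slice checks (`[0,13)`, `[13,25)` — slice shapes chosen not to repeat another rung's validity file), and ONE
propositional conjunction (`inputs_valid`: `0 < a ∧ PrimeData a ks ∧ ConstsValid (2^80) a ks C ∧ TabValid (2^80) a ks 25 tab`).  Inputs: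
`π ∈ P`, `a = 693/2000 ∈ A` (`checkFrac`), the constants record, the EMPTY prime data (`checkPrimeDataSep … kmax = 1`: `log 2 > 2a` by
interval arithmetic) and the table slices `[0, 13)`, `[13, 25)` of `RigidityDataA03465.tab`.  Same shape as `RigidityTableLog4Half`
(gen16).  RH-free; no definitions; standard axioms; nothing here bears on the truth of RH.
-/

set_option linter.dupNamespace false
set_option maxRecDepth 200000
set_option autoImplicit false

namespace Summit.Ventures.WeilGRH.Christoffel.A03465

open Literature.NumberTheory.LFunctions Literature.NumberTheory.LFunctions.Yoshida1992 Encl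
  Literature.Analysis.ValidatedNumerics.NumericsMP

set_option maxHeartbeats 0 in
/-- kernel: `π ∈ P`, `a = 693/2000 ∈ A`, the constants record and the (empty) prime data — one conjunction. -/
theorem checks_primeFree :
    (checkPi (2 ^ 80) 70 P && checkFrac (2 ^ 80) 693 2000 A && checkConsts prm P A ks C &&
      checkPrimeDataSep (2 ^ 80) 96 A 1 ks) = true := by
  decide +kernel

set_option maxHeartbeats 0 in
/-- kernel: table slice `[0, 13)` of the prime-free table, recomputed and contained. -/
theorem table_primeFree_A : checkTable prm C tab 0 13 = true := by
  decide +kernel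

set_option maxHeartbeats 0 in
/-- kernel: table slice `[13, 25)` of the prime-free table. -/
theorem table_primeFree_B : checkTable prm C tab 13 12 = true := by
  decide +kernel

/-- **The inputs of the prime-free certificates are valid**: `0 < a`, the prime data of the window is EMPTY, the constants record is
valid, and the special-value table is valid below mode `25` (the data file carries modes `0 … 40`). -/
theorem inputs_valid :
    (0 : ℝ) < a ∧ PrimeData a ks ∧ ConstsValid (2 ^ 80) a ks C ∧ TabValid (2 ^ 80) a ks 25 tab := by
  have h := checks_primeFree
  simp only [Bool.and_eq_true] at h
  obtain ⟨⟨⟨hP, hA⟩, hC⟩, hK⟩ := h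
  have hT0 := table_primeFree_A
  have hT1 := table_primeFree_B
  have ha0 : (0 : ℝ) < a := by unfold a; norm_num
  have hpi : MI.mem (2 ^ 80) Real.pi P := mem_pi_of_checkPi (by norm_num) hP
  have ha : MI.mem (2 ^ 80) a A := by
    unfold a
    exact mem_of_checkFrac (S := 2 ^ 80) hA
  have hc : ConstsValid (2 ^ 80) a ks C :=
    constsValid_of_checkConsts (prm := prm) (by norm_num [prm]) (by norm_num [prm]) hpi ha hC
  have hk : PrimeData a ks := primeData_of_checkSep (S := 2 ^ 80) (by norm_num) ha hK
  have h1 : TabValid (2 ^ 80) a ks (0 + 13) tab :=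
    (TabValid.zero (S := 2 ^ 80) (a := a) (ks := ks) (tab := tab)).extend fun n hn hnk ↦
      idxValid_of_checkTable (prm := prm) (by norm_num [prm]) ha0 hc hT0 hn hnk
  exact ⟨ha0, hk, hc, h1.extend fun n hn hnk ↦ idxValid_of_checkTable (prm := prm) (by norm_num [prm]) ha0 hc hT1 hn hnk⟩

end Summit.Ventures.WeilGRH.Christoffel.A03465
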